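import Mathlib
import HarnessLib
import Summits.QuantumAdvantage.QuantumAdvantage.Theorems.DigitDialD
import Summits.QuantumAdvantage.QuantumAdvantage.Theorems.DigitDialL

set_option linter.dupNamespace false
set_option autoImplicit false

/-!
# DigitDial (M) — the quad-chain class reaches OUTSIDE the linear-rank class: `W⁶ ⊄ W⁵` (cell decomp-qadv, lens 4, g20 rev 7)

Prop-definition-free tree twin of §10g of the lens-4 g20 node `DigitDial`.  The INNER-PRODUCT chain strategy
`ipStrat M n` (every cut fires iff `Σ_s u_{2s} u_{2s+1} ≡ 0 (mod M)`; it is `qStrat (ipQ M n) 0 (· = 0)` of `DigitDialL`) is not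
`linStrat lam tab` (`DigitDialD`) for ANY `K ≤ (log₂ n)^C` linear forms modulo ANY `M' ≤ (log₂ n)^C` and any tables, once
`4(log₂ n)^{2C} ≤ n`: `ipStrat_ne_linStrat`.  Ingredients: `embU` (test words on the even sites + one odd site), `phiE` (even part of
the linear statistic), `linVal_embU`, `quadChain_embU` (the chain form on a test word reads one bit), `ipStrat_embU`,
`pow_lt_two_pow_half` (`M'^K < 2^{n/2}`), `log_le_card_ipQ` (the witness has `≥ log₂ n` non-zero quadratic coefficients, i.e. lies in
the node's class `IsQuadChainP`).  0 sorry; axioms standard; no `instance`, no `notation`, no `native_decide`; no `def … : Prop`.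
-/

noncomputable section

namespace Summit.QuantumAdvantage.QuantumAdvantage.Theorems.DigitDial

open Finset Summit.QuantumAdvantage.AdviceFreeQNC0 Literature.Computability.MetaComplexity
open TwistedTransfer ConstBells

section SeparationM

open TwistQ

variable {n K : ℕ} {M : ℕ}

/-- The INNER-PRODUCT chain: quadratic coefficient `1` on the bonds `(2s, 2s+1)`, no linear part. -/
def ipQ (M n : ℕ) : Fin n → ZMod M := fun i => if i.val % 2 = 1 then 1 else 0

/-- The witness strategy `y⋆`: every cut fires iff `Σ_s u_{2s} u_{2s+1} ≡ 0 (mod M)`. -/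
def ipStrat (M n : ℕ) : Fin (n + 1) → (Fin n → Bool) → Bool :=
  qStrat (ipQ M n) (fun _ => 0) (fun _ v => decide (v = 0))

/-- The test inputs: `x ∈ {0,1}^m` written on the even sites `2s` (`s < m`), plus the single odd site `t`. -/
def embU {m : ℕ} (n : ℕ) (x : Fin m → Bool) (t : ℕ) : Fin n → Bool :=
  fun i => if i.val % 2 = 0 then bitAt x (i.val / 2) else decide (i.val = t)

/-- The even part of the linear statistic of a test input (independent of the odd site `t`). -/
def phiE {m : ℕ} (lam : Fin K → Fin n → ZMod M) (x : Fin m → Bool) : Fin K → ZMod M :=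
  fun k => ∑ i : Fin n, if i.val % 2 = 0 ∧ bitAt x (i.val / 2) = true then lam k i else 0

/-- `linVal (embU x t) = phiE x + (the odd site's column)`, for odd `t`. -/
theorem linVal_embU {m : ℕ} (lam : Fin K → Fin n → ZMod M) (x : Fin m → Bool) {t : ℕ} (ht : t % 2 = 1) :
    linVal lam (embU n x t) = fun k => phiE lam x k + ∑ i : Fin n, if i.val = t then lam k i else 0 := by
  funext k
  unfold linVal phiE
  rw [← Finset.sum_add_distrib]
  refine Finset.sum_congr rfl fun i _ => ?_
  unfold embU
  by_cases hi : i.val % 2 = 0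
  · have hit : i.val ≠ t := fun h => by omega
    simp [hi, hit]
  · have hi1 : i.val % 2 = 1 := by omega
    by_cases hit : i.val = t
    · simp [hit, ht]
    · simp [hi, hit]

/-- The chain form on a test input with odd site `t = 2s+1` reads exactly the bit `x_s`. -/
theorem quadChain_embU {m : ℕ} (x : Fin m → Bool) {s : ℕ} (hs : s < m) (hn : 2 * s + 1 < n) :
    quadChain (ipQ M n) (fun _ => 0) (embU n x (2 * s + 1)) = if x ⟨s, hs⟩ then 1 else 0 := by
  unfold quadChain
  rw [Finset.sum_eq_single ⟨2 * s + 1, hn⟩]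
  · have hu : embU n x (2 * s + 1) ⟨2 * s + 1, hn⟩ = true := by
      unfold embU; simp
    have hprev : prevN false (embU n x (2 * s + 1)) (2 * s + 1) = x ⟨s, hs⟩ := by
      unfold prevN
      rw [if_neg (by omega)]
      show bitAt (embU n x (2 * s + 1)) (2 * s + 1 - 1) = _
      have h2s : 2 * s + 1 - 1 = 2 * s := by omega
      rw [h2s]
      unfold bitAt
      rw [dif_pos (by omega)]
      unfold embU
      simp only [Nat.mul_mod_right, ↓reduceIte]
      show bitAt x (2 * s / 2) = _
      rw [Nat.mul_div_cancel_left s two_pos]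
      unfold bitAt
      rw [dif_pos hs]
    have hq : ipQ M n ⟨2 * s + 1, hn⟩ = 1 := by unfold ipQ; simp
    rw [hu, hprev, hq]
    simp
  · intro i _ hi
    by_cases hpar : i.val % 2 = 0
    · have hq : ipQ M n i = 0 := by unfold ipQ; simp [hpar]
      rw [hq]; simp
    · have hu : embU n x (2 * s + 1) i = false := by
        unfold embU
        rw [if_neg hpar]
        have : i.val ≠ 2 * s + 1 := fun h => hi (Fin.ext h)
        simp [this]
      rw [hu]; simp
  · intro h; exact absurd (Finset.mem_univ _) h

/-- The witness strategy at cut `0` on a test input: fires iff `x_s = 0` (needs `(1 : ℤ/M) ≠ 0`). -/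
theorem ipStrat_embU (hM : 1 < M) {m : ℕ} (x : Fin m → Bool) {s : ℕ} (hs : s < m) (hn : 2 * s + 1 < n) :
    ipStrat M n 0 (embU n x (2 * s + 1)) = !x ⟨s, hs⟩ := by
  unfold ipStrat qStrat
  rw [quadChain_embU x hs hn]
  haveI : Fact (1 < M) := ⟨hM⟩
  by_cases hx : x ⟨s, hs⟩ = true
  · simp [hx]
  · simp [hx]

/-- Polylog bookkeeping: `M, K ≤ L^C` and `4·L^{2C} ≤ n` give `M^K < 2^{n/2}`. -/
theorem pow_lt_two_pow_half {L C n : ℕ} {M K : ℕ} (hL : 1 ≤ L) (hM : M ≤ L ^ C) (hK : K ≤ L ^ C)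
    (hn : 4 * L ^ (2 * C) ≤ n) : M ^ K < 2 ^ (n / 2) := by
  have hLC : 1 ≤ L ^ C := Nat.one_le_pow _ _ hL
  have h1 : M ^ K ≤ (L ^ C) ^ (L ^ C) :=
    le_trans (Nat.pow_le_pow_left hM K) (Nat.pow_le_pow_right hLC hK)
  have h2 : (L ^ C) ^ (L ^ C) ≤ (2 ^ (L ^ C)) ^ (L ^ C) := Nat.pow_le_pow_left (Nat.lt_two_pow_self).le _
  have h3 : (2 ^ (L ^ C)) ^ (L ^ C) = 2 ^ (L ^ (2 * C)) := by
    rw [← pow_mul, ← pow_add]; ring_nf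
  have h4 : L ^ (2 * C) < n / 2 := by
    have hL2 : 1 ≤ L ^ (2 * C) := Nat.one_le_pow _ _ hL
    have : (L ^ (2 * C) + 1) * 2 ≤ n := by nlinarith
    have := (Nat.le_div_iff_mul_le two_pos).2 this
    omega
  calc M ^ K ≤ 2 ^ (L ^ (2 * C)) := by rw [← h3]; exact h1.trans h2
    _ < 2 ^ (n / 2) := Nat.pow_lt_pow_right (by norm_num) h4

/-- `log₂ n ≤ n / 2`. -/
theorem log_two_le_half (n : ℕ) : Nat.log 2 n ≤ n / 2 := by
  rcases Nat.eq_zero_or_pos n with h | h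
  · subst h; simp
  · have h1 : 2 ^ Nat.log 2 n ≤ n := Nat.pow_log_le_self 2 h.ne'
    -- landing note (census-1 g10): the lens's helper `two_mul_le_two_pow` restates the landed
    -- `Literature.NumberTheory.EllipticCurves.two_mul_le_two_pow` (gate dedup); its 7-line proof is inlined here instead of importing an
    -- elliptic-curve module into this file.
    have h2 : 2 * Nat.log 2 n ≤ 2 ^ Nat.log 2 n := by
      generalize Nat.log 2 n = k
      induction k with
      | zero => simp
      | succ k ih =>
        rcases Nat.eq_zero_or_pos k with h | h
        · subst h; simp
        · have : 1 ≤ 2 ^ k := Nat.one_le_two_pow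
          rw [pow_succ]; omega
    exact (Nat.le_div_iff_mul_le two_pos).2 (by omega)

/-- The inner-product chain has `≥ n/2 ≥ log₂ n` non-zero quadratic coefficients (`(1 : ℤ/M) ≠ 0`). -/
theorem log_le_card_ipQ (hM : 1 < M) (n : ℕ) :
    Nat.log 2 n ≤ (univ.filter fun i : Fin n => ipQ M n i ≠ 0).card := by
  haveI : Fact (1 < M) := ⟨hM⟩
  refine (log_two_le_half n).trans ?_
  have hsub : (univ : Finset (Fin (n / 2))).image (fun s => (⟨2 * s.val + 1, by omega⟩ : Fin n)) ⊆
      univ.filter fun i : Fin n => ipQ M n i ≠ 0 := by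
    intro i hi
    simp only [Finset.mem_image, Finset.mem_univ, true_and] at hi
    obtain ⟨s, rfl⟩ := hi
    simp only [Finset.mem_filter, Finset.mem_univ, true_and]
    unfold ipQ
    have : (2 * s.val + 1) % 2 = 1 := by omega
    simp [this]
  have hcard : ((univ : Finset (Fin (n / 2))).image (fun s => (⟨2 * s.val + 1, by omega⟩ : Fin n))).card = n / 2 := by
    rw [Finset.card_image_of_injective _ (fun a b h => by
      have := congrArg Fin.val h; exact Fin.ext (by simpa using this))]
    simp
  rw [← hcard]
  exact Finset.card_le_card hsub

/-- **`W⁶ ⊄ W⁵` (Prop-definition-free form of the node's `ipStrat_not_linRank`).**  If `1 < M`, `M', K ≤ L^C` with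
`L = log₂ n ≥ 1` and `4·L^{2C} ≤ n`, then the inner-product chain strategy mod `M` is NOT `linStrat lam tab` for any `K` linear
forms mod `M'` and any tables: pigeonhole on the even statistic `phiE` (`M'^K < 2^{n/2}`) gives test words `x ≠ x'` on the even
sites that every `linStrat lam tab` confuses at cut `0` on `embU · (2s+1)`, while `ipStrat` reads `¬x_s ≠ ¬x'_s` there. -/
theorem ipStrat_ne_linStrat (hM : 1 < M) {M' K C : ℕ} [NeZero M'] (hL : 1 ≤ Nat.log 2 n) (hMle : M' ≤ Nat.log 2 n ^ C)
    (hK : K ≤ Nat.log 2 n ^ C) (hn : 4 * Nat.log 2 n ^ (2 * C) ≤ n) (lam : Fin K → Fin n → ZMod M')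
    (tab : Fin (n + 1) → (Fin K → ZMod M') → Bool) : ipStrat M n ≠ linStrat lam tab := by
  intro hy
  have hlt : M' ^ K < 2 ^ (n / 2) := pow_lt_two_pow_half hL hMle hK hn
  have hcard : Fintype.card (Fin K → ZMod M') < Fintype.card (Fin (n / 2) → Bool) := by
    simpa [Fintype.card_fun, ZMod.card, Fintype.card_fin, Fintype.card_bool] using hlt
  obtain ⟨x, x', hne, hφ⟩ := Fintype.exists_ne_map_eq_of_card_lt (phiE (n := n) lam) hcard
  obtain ⟨s, hs⟩ := Function.ne_iff.1 hne
  have h2s : 2 * s.val + 1 < n := by have := s.isLt; omega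
  have hval : ∀ z : Fin (n / 2) → Bool, ipStrat M n 0 (embU n z (2 * s.val + 1)) =
      tab 0 (fun k => phiE lam z k + ∑ i : Fin n, if i.val = 2 * s.val + 1 then lam k i else 0) := by
    intro z
    have := congrFun (congrFun hy 0) (embU n z (2 * s.val + 1))
    rw [this]
    unfold linStrat
    rw [linVal_embU lam z (by omega)]
  have heq : ipStrat M n 0 (embU n x (2 * s.val + 1)) = ipStrat M n 0 (embU n x' (2 * s.val + 1)) := by
    rw [hval x, hval x']
    have hφ' : ∀ k, phiE lam x k = phiE lam x' k := fun k => congrFun hφ k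
    simp_rw [hφ']
  rw [ipStrat_embU hM x s.isLt h2s, ipStrat_embU hM x' s.isLt h2s] at heq
  exact hs (by simpa using heq)

end SeparationM

end Summit.QuantumAdvantage.QuantumAdvantage.Theorems.DigitDial
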